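import Summits.BirchSwinnertonDyer.Rank1Residual.Additive.QuadraticBranchOddStrictSelmer
import HarnessLib

/-!
# Odd `η`-branch, consumers: the certificate sub-class `OddBranchUnitCertificateAt W p` and
# `typed inputs + two PER-PAIR CERTIFICATES + r_an(W) = 1 ⟹ BSD(W, p)` with NO `p`-adic height
# (cell `b2b-bsdres`, lane CLASS-CLOSURE, seat cc-typer-6 GEN 5; class served: O7-ss ∩ `e = 2`,
# NON-CM — the VERBATIM-EXTENSION sub-class handed to n1011 / cc-typer-2, endorsed by the O10 lead's
# RULING `class-closure/O10/RULING-ETA-ODD-STRICT-x1b.md` §3; NOT an O10 route — same ruling §0)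

HONEST FRAMING (cell `b2b-bsdres`, run/shared/lean/b2b/bsd-rank1-residual/, verbatim in every
file): the goal of the cell is to DELETE the COMBINATION-SHAPED residual classes of the
Birch–Swinnerton-Dyer formula for ALL analytic-rank `≤ 1` elliptic curves over `ℚ` — "full BSD
formula for every rank `≤ 1` curve in class `C`" assembled STRICTLY from published theorems — so
that the rank-`≤ 1` remainder becomes exactly the CONSTRUCTION-SHAPED classes, which are TYPED
(missing-input `Prop`s), NOT attempted. This is not "finishing BSD". Lane CLASS-CLOSURE
(coordinator ruling 2026-08-21T04:07:19Z): research routes; no claim beyond the stated classes;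
census / instrument output is EVIDENCE, never a Literature fact; per-pair certificates are
INSTRUMENTATION (E4), never coverage. This file: ONE sub-class predicate (definition with body)
and PROVED bookkeeping theorems, every one CONDITIONAL on the typed inputs of the sibling file
`QuadraticBranchOddStrictSelmer.lean` (`QuadraticBranchOddStrictSelmerBoundAt` /
`QuadraticBranchOddStrictSelmerBoundOfPlusMCAt` — theorem-shaped assemblies of Kobayashi 2003
Thm. 4.1 (odd, `η ≠ 1`) / Thm. 7.4 + Thm. 2.2 + Kitajima–Otsuki 2018 Main Thm. 1.3 + Lemma 9.1,
UNWRITTEN as assemblies — and the elementary `StrictSelmerDominatesShaAt`); no named fact is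
minted (net debt `0`); nothing is booked; no label of `RESIDUAL-MAP.md` moves; the classes served
stay CONSTRUCTION-SHAPED / OPEN.

## What is here

* `OddBranchUnitCertificateAt W p` — the record-shaped CERTIFICATE sub-class: the good twist
  `V = W^{(p*)}` (`a_p(V) = 0`), its newform and period ratio, and a function with the
  interpolation property of `L_p⁻(V, η, X)` (Kobayashi (3.5) + (3.7)) whose coefficient of `X` —
  the constant term of the printed generator `X⁻¹L_p⁻(V, η, X)` of the odd main conjecture — is a
  `p`-adic UNIT: `(μ, λ) = (0, 1)` on the odd branch. The twin of the lane's `λ`-MINIMAL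
  certificates.
* `bsdp_of_oddStrictSelmerBound_of_unit` (surjective `ρ_{V,p^∞}`: Thm. 4.1 with `n = 0`
  PRINTED) and `bsdp_of_oddStrictSelmerBoundOfPlusMC_of_unit` (image-free: the sibling's typed
  (C1_η) `QuadraticBranchPlusMainConjectureAt V p` through Thm. 7.4 instead of the image hypothesis
  — a CONDITIONAL form for the NON-surjective twins): typed inputs + certificate (i)
  `coeff₁ ∈ ℤ_p^×` + certificate (ii) `ord_p #Ш(W)_an = 0` + `r_an(W) = 1` (GZK by name) ⟹
  Miller's `BSD(W, p)`. The chain: the bound gives `ord_p #Sel_str(W/ℚ)[p^∞] ≤ v_p(coeff₁) = 0`;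
  `#Ш(W)[p^∞] ∣ #Sel_str` in rank one; so `ord_p #Ш(W)[p^∞] = 0 = ord_p #Ш_an`. NO `p`-adic
  height, NO Schneider hypothesis, NO Gross–Zagier formula on the branch: the "regulator" of the
  odd branch is `log_ω(P)²` (Kurihara–Pollack 2007 p. 351, §1.5).
* `bsdp_of_oddBranchUnitCertificate` — packaged sub-class form (record ∧ surjectivity ∧ (ii)).

SCOPE (O10 class lead's RULING `class-closure/O10/RULING-ETA-ODD-STRICT-x1b.md`, sha16
`a8bd8e04d6a47657`, 2026-08-21T09:32Z, adopted verbatim): the chain is an UPPER bound on `Ш` (the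
Euler-system direction, `Typed.MissingUpperBoundAt`). **On O10 (X12, CM) it is NOT adopted and
this file is NOT an O10 route**: there the upper half is already a kernel theorem from published
facts for every pair (`X12/InertCoreUpperHalf.lean`, `InertCoreEveryCurve*`), all 995 O10 class
pairs have `ord_p #Ш_an = 0` and are decided per pair of record (T-MN19 / T-KR), and the class
residue is the LOWER half (STEP L, `X12/InertCoreStepL.lean`), which no upper bound touches; the
O10 node of record (p255460) is unchanged. **Where it is NEW (ruling §3, endorsed): O7-ss ∩
`e = 2` ∩ `r_an = 1` ∩ NON-CM with `ρ_{V,p^∞}` onto** — a twist-free per-pair upper half, hence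
`BSD(W, p)` on the certified pairs, whose only open input at that prime was the rank-`0` twist's
lower half (`AdditivePotMult.padicValNat_shaOrder_le_add_of_heegnerData_of_lowerTwist`); the O7
owners (cc-typer-2 / n1011 r = 1 strand) decide whether to take it, after checking T-MN19's per-pair
coverage of those cells (marginal value = MN19-resistant rows + the twist-free class-level SHAPE).
This seat types no O7 class predicate; the sub-class in the tree's names is `ClassX4 W p` ∧
`Additive.SubGss` (`e = 2`) ∧ `W.analyticRank = 1` ∧ `¬ CM` ∧ `ρ_{V,p^∞}` onto ∧ (i) ∧ (ii).

EVIDENCE (census / instruments, never a fact): the sub-class universe from cc-eng-1's obsanat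
`class-closure/O7/pairs.tsv` (sha16 `27107d0f55816358`, 31 429 O7 cells; read by this seat, local,
seconds): `red = add(f=2,G-ss)` ∧ `family = X4` ∧ `img = surj` (mod `p`) ∧ `r = 1` ∧ `cm = False`
= **1 855 cells** (`p = 3`: 1 561 — there `a_3(V) = 0` and surjectivity mod `9` are extra per-pair
bits; `p = 5`: 266; `p = 7`: 20; `p = 11`: 6; `p = 17`: 2), `ord_p #Ш_an = 0` on 1 838 of them
(17 carry `ord_p #Ш_an = 2`: outside certificate (ii)), `cell_closed_of_record` EMPTY on all 1 855;
neighbours not served: X3 (Borel image) ∧ `f = 2` ∧ G-ss 3 112 cells, X4 small image 253.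

Instrument behaviour of certificate (i) (EVIDENCE, on CM twins where the route is REDUNDANT per the
ruling; quoted only to show what the engine reads): x1b gen 25 E1-η (PREREG `22e0f8026e4f6932`,
`all_RES` v2 `88c4ce37a320482a`; second-scored digit for digit by this seat,
`HOME/class-closure/O10/E1-ETA-SCORE2-v2-typer6.md`): the `ω`-coordinate `C1 = L_p⁻(V, η, X)·log⁺·
(const)` has its (3.7)-forced zero on 824/824 rows, order EXACTLY `1` on 274/274 rank-one pairs
(= `coeff₁ ≠ 0`), and `v_p(a₁ of C1) = 2ν − 1` (`ν` = LOCDIV level of the generator; `ν = 0` on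
257/274) — i.e. certificate (i) ⟺ `ν = 0` modulo the PARI constant (route note item (L3)). For the
NON-CM sub-class above the same two engines (E1-η kind PS, LOCDIV) apply verbatim: population H-a of
`O10/E1-S2SHARP-PREREG-DRAFT-typer6.md` (x1b-countersigned with amendments A1–A6; not run; one job
would serve the S2♯ held-out AND these certificates). Numbers are quoted, not used.

References: [Kobayashi2003] (3.5), (3.7) (p. 7), §4 + Thm. 4.1 (p. 8), Thm. 7.4 (p. 13), Lemma 9.1
(p. 25); [KitajimaOtsuki2018] Main Thm. 1.3; [KuriharaPollack2007] §1.5 (p. 361), p. 351;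
[PollackRubin2004] p. 448; [Miller2011LMS] §1, Def. 1.1; [Darmon2004] Thm. 3.22;
[GreenbergLNM1716] §2 pp. 62–63.
-/

noncomputable section

open scoped Classical MatrixGroups ModularForm

open CongruenceSubgroup Polynomial WeierstrassCurve Literature.NumberTheory.EllipticCurves
  Literature.NumberTheory.EllipticCurves.ModularForms
  Literature.NumberTheory.EllipticCurves.Kobayashi2003
  Literature.NumberTheory.EllipticCurves.Rank1Residual
  Literature.NumberTheory.EllipticCurves.Rank1Residual.Typed
  Literature.NumberTheory.GaloisRepresentations ZpExtension

namespace Summit.BirchSwinnertonDyer.Rank1Residual.Additive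

/-! ## The certificate sub-class and the PROVED consumers `⟹ BSD(W, p)` -/

section Consumers

variable (W : WeierstrassCurve ℚ) [W.IsElliptic] [W.IsGloballyMinimal] (p : ℕ) [Fact p.Prime]

/-- **SUB-CLASS PREDICATE (record-shaped CERTIFICATE; instrumentation, never coverage): the odd
`η`-branch function of the good twist is `X` times a UNIT of `Λ`, i.e. `(μ, λ)(L_p⁻(V, η, X)) =
(0, 1)`.** Data: `V` globally minimal with `C • W.quadraticTwist p* = V`, good at `p`, `a_p(V) =
0`; the newform `f` of `V`; the period ratio `ϖ`; a function `Lη` with the interpolation property of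
§1 whose coefficient of `X` is a `p`-adic unit. In x1b's E1-η engine (PARI `mspadicseries` on the
`ω^{(p−1)/2}`-component, `ω`-coordinate `C1 = L_p⁻·log⁺·const`) this is "`ord_X C1 = 1` and
`v_p(a₁ of C1) = ` the normalisation constant", modulo route-note item (L3) (the constant; EVIDENCE:
K0 rows calibrate it). The twin, on the odd branch, of the lane's `λ`-MINIMAL certificates
`(μ_an, λ_an) = (0, r + e)`. A predicate; nothing booked.
[cite: Kobayashi2003, (3.5) and (3.7) (p. 7), §4 (p. 8)] -/
def OddBranchUnitCertificateAt : Prop :=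
  ∃ (V : WeierstrassCurve ℚ) (_ : V.IsElliptic) (_ : V.IsGloballyMinimal) (C : VariableChange ℚ)
    (N : ℕ) (_ : NeZero N) (f : CuspForm (Gamma0 N) 2) (ϖ : ℚ) (Lη : IwasawaAlgebra p),
    C • W.quadraticTwist ((-1) ^ (p / 2) * p) = V ∧
    V.HasGoodReductionAtPrime p ∧ V.frobeniusTrace p = 0 ∧ IsNewformOf V f ∧
    (if Even (p / 2) then (ϖ : ℝ) * V.realPeriodRat = plusPeriod f
        else (ϖ : ℝ) * V.imaginaryPeriodRat = minusPeriod f) ∧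
    IsQuadraticBranchMinusLFunction f p ϖ Lη ∧ IsUnit (PowerSeries.coeff 1 Lη)

variable {W p}

omit [W.IsElliptic] [W.IsGloballyMinimal] in
/-- **Bottom-layer bound + unit certificate ⟹ `p ∤ #Sel_str(W/ℚ)[p^∞]`.** From the output of a
§3 input at a pair and `coeff₁ Lη ∈ ℤ_p^×` (`v_p = 0`): the strict group is finite of order prime
to `p`. Bookkeeping. [cite: Kobayashi2003, Thm. 4.1 (p. 8)] -/
theorem padicValNat_card_strictSelmerPInfty_eq_zero_of_bound {Lη : IwasawaAlgebra p}
    (hB : Finite ↥(strictSelmerPInfty W p) ∧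
      (padicValNat p (Nat.card ↥(strictSelmerPInfty W p)) : ℤ) ≤
        ((PowerSeries.coeff 1 Lη : ℤ_[p]) : ℚ_[p]).valuation)
    (hunit : IsUnit (PowerSeries.coeff 1 Lη)) :
    Finite ↥(strictSelmerPInfty W p) ∧ padicValNat p (Nat.card ↥(strictSelmerPInfty W p)) = 0 := by
  obtain ⟨hfin, hle⟩ := hB
  obtain ⟨u, hu⟩ := hunit
  rw [← hu, valuation_coe_units_eq_zero p u] at hle
  refine ⟨hfin, ?_⟩
  omega

omit [W.IsGloballyMinimal] in
/-- **… and with the elementary input §4 in rank `≥ 1`: `p ∤ #Ш(W)` (for finite `Ш`).** If `W(ℚ)`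
has a point of infinite order, `StrictSelmerDominatesShaAt` gives `#Ш(W)[p^∞] ∣ #Sel_str`, whose
order is prime to `p`; hence `ord_p #Ш(W)[p^∞] = 0`. Bookkeeping. [cite: GreenbergLNM1716, §2 (pp. 62–63)] -/
theorem padicValNat_card_shaPrimary_eq_zero_of_bound {Lη : IwasawaAlgebra p}
    (hL6 : StrictSelmerDominatesShaAt W p) (hP : 1 ≤ W.mordellWeilRank)
    (hB : Finite ↥(strictSelmerPInfty W p) ∧
      (padicValNat p (Nat.card ↥(strictSelmerPInfty W p)) : ℤ) ≤
        ((PowerSeries.coeff 1 Lη : ℤ_[p]) : ℚ_[p]).valuation)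
    (hunit : IsUnit (PowerSeries.coeff 1 Lη)) :
    padicValNat p (Nat.card (AddCommGroup.primaryComponent W.sha p)) = 0 := by
  obtain ⟨hfin, h0⟩ := padicValNat_card_strictSelmerPInfty_eq_zero_of_bound hB hunit
  haveI := hfin
  have hdvd := hL6 hP
  have hpos : 0 < Nat.card ↥(strictSelmerPInfty W p) := Nat.card_pos
  have hle : padicValNat p (Nat.card (AddCommGroup.primaryComponent W.sha p)) ≤
      padicValNat p (Nat.card ↥(strictSelmerPInfty W p)) := by
    rw [← padicValNat_dvd_iff_le hpos.ne']
    exact pow_padicValNat_dvd.trans hdvd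
  omega

variable (W p)

/-- **END-TO-END, surjective form (the VERBATIM-EXTENSION sub-class of O7-ss ∩ `e = 2`, non-CM):**
granted GZK (`hGZK`, for `rank = r_an = 1` and `Ш` finite), the typed inputs
`QuadraticBranchOddStrictSelmerBoundAt W p` (§3) and `StrictSelmerDominatesShaAt W p` (§4), a pair
`(W, p)` with `W^{(p*)} ≅ V` good, `a_p(V) = 0`, `ρ_{V,p^∞}` onto, of analytic rank one, carrying
the TWO PER-PAIR CERTIFICATES (i) `coeff₁ L_p⁻(V, η, X) ∈ ℤ_p^×` (odd branch `(μ, λ) = (0, 1)`) and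
(ii) `ord_p #Ш(W)_an = 0`, satisfies Miller's **`BSD(W, p)`**: `Ш(W)[p^∞]` has order prime to `p`
by the two theorems above and `#Ш_an` has `p`-adic valuation `0` by (ii). NO `p`-adic height, NO
Schneider hypothesis, NO Gross–Zagier formula on the branch enters. CONDITIONAL on the typed inputs;
nothing booked; no label moves. [cite: Miller2011LMS, §1 and Def. 1.1] [cite: Darmon2004, Thm. 3.22]
[cite: Kobayashi2003, Thm. 4.1 (p. 8) and Lemma 9.1 (p. 25)] -/
theorem bsdp_of_oddStrictSelmerBound_of_unit (hGZK : rank_eq_analyticRank_of_analyticRank_le_one)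
    (h : QuadraticBranchOddStrictSelmerBoundAt W p) (hL6 : StrictSelmerDominatesShaAt W p)
    {V : WeierstrassCurve ℚ} [V.IsElliptic] [V.IsGloballyMinimal] {C : VariableChange ℚ}
    {N : ℕ} [NeZero N] {f : CuspForm (Gamma0 N) 2} {ϖ : ℚ} {Lη : IwasawaAlgebra p}
    (hp : p ≠ 2) (hC : C • W.quadraticTwist ((-1) ^ (p / 2) * p) = V)
    (hgood : V.HasGoodReductionAtPrime p) (hap : V.frobeniusTrace p = 0)
    (hsurj : ∀ m : ℕ, V.HasSurjectiveModNGaloisRep (p ^ m : ℕ)) (hf : IsNewformOf V f)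
    (hϖ : if Even (p / 2) then (ϖ : ℝ) * V.realPeriodRat = plusPeriod f
        else (ϖ : ℝ) * V.imaginaryPeriodRat = minusPeriod f)
    (hL : IsQuadraticBranchMinusLFunction f p ϖ Lη) (hunit : IsUnit (PowerSeries.coeff 1 Lη))
    (hsha : ∃ q : ℚ, shaAn W = (q : ℂ) ∧ padicValRat p q = 0) (hr : W.analyticRank = 1) :
    BSDp W p := by
  obtain ⟨hrank, hfin⟩ := hGZK W hr.le
  haveI : Finite W.sha := hfin
  have hrank1 : 1 ≤ W.mordellWeilRank := by rw [hrank, hr]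
  have hB := h V C hp hC hgood hap hsurj hf ϖ hϖ Lη hL hunit.ne_zero
  have h0 := padicValNat_card_shaPrimary_eq_zero_of_bound hL6 hrank1 hB hunit
  obtain ⟨q, hq, hv⟩ := hsha
  refine ⟨hrank, inferInstance, q, hq, ?_⟩
  rw [hv, h0, Nat.cast_zero]

/-- **END-TO-END, image-free (main-conjecture) form:** the same with the image hypothesis replaced
by the sibling's typed (C1_η) `QuadraticBranchPlusMainConjectureAt V p` and the §3 input
`QuadraticBranchOddStrictSelmerBoundOfPlusMCAt W p` — a CONDITIONAL form for twins `V` whose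
`p`-adic image is NOT onto (Thm. 4.1's `n` not effective). By the O10 class lead's ruling (module
docstring) this is NOT an O10 route: on the CM class the conclusion is already decided per pair by
T-MN19 / T-KR and the class residue is the lower half; it is recorded for the NON-CM twins whose
image is not onto (the 253 small-image X4 cells of the sub-class census in the module docstring;
on the X3 = reducible-image rows the integral conjecture (C1_η) is lattice-sensitive and this seat
makes no claim). CONDITIONAL on two typed inputs; nothing booked; no label moves.
[cite: Kobayashi2003, Thm. 7.4 (p. 13) and §4 (p. 8)] [cite: PollackRubin2004, p. 448 (remark)]
[cite: Miller2011LMS, §1 and Def. 1.1] [cite: Darmon2004, Thm. 3.22] -/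
theorem bsdp_of_oddStrictSelmerBoundOfPlusMC_of_unit
    (hGZK : rank_eq_analyticRank_of_analyticRank_le_one)
    (h : QuadraticBranchOddStrictSelmerBoundOfPlusMCAt W p) (hL6 : StrictSelmerDominatesShaAt W p)
    {V : WeierstrassCurve ℚ} [V.IsElliptic] [V.IsGloballyMinimal] {C : VariableChange ℚ}
    {N : ℕ} [NeZero N] {f : CuspForm (Gamma0 N) 2} {ϖ : ℚ} {Lη : IwasawaAlgebra p}
    (hp : p ≠ 2) (hC : C • W.quadraticTwist ((-1) ^ (p / 2) * p) = V)
    (hgood : V.HasGoodReductionAtPrime p) (hap : V.frobeniusTrace p = 0)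
    (hMC : QuadraticBranchPlusMainConjectureAt V p) (hf : IsNewformOf V f)
    (hϖ : if Even (p / 2) then (ϖ : ℝ) * V.realPeriodRat = plusPeriod f
        else (ϖ : ℝ) * V.imaginaryPeriodRat = minusPeriod f)
    (hL : IsQuadraticBranchMinusLFunction f p ϖ Lη) (hunit : IsUnit (PowerSeries.coeff 1 Lη))
    (hsha : ∃ q : ℚ, shaAn W = (q : ℂ) ∧ padicValRat p q = 0) (hr : W.analyticRank = 1) :
    BSDp W p := by
  obtain ⟨hrank, hfin⟩ := hGZK W hr.le
  haveI : Finite W.sha := hfin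
  have hrank1 : 1 ≤ W.mordellWeilRank := by rw [hrank, hr]
  have hB := h V C hp hC hgood hap hMC hf ϖ hϖ Lη hL hunit.ne_zero
  have h0 := padicValNat_card_shaPrimary_eq_zero_of_bound hL6 hrank1 hB hunit
  obtain ⟨q, hq, hv⟩ := hsha
  refine ⟨hrank, inferInstance, q, hq, ?_⟩
  rw [hv, h0, Nat.cast_zero]

/-- **Sub-class form (for obsanat / the O7 typer: the predicate to census is
`OddBranchUnitCertificateAt W p` ∧ `ρ_{W,p^∞}` onto ∧ `ord_p #Ш_an = 0`, on `Additive.SubGss` rows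
with `e = 2`, `r_an = 1`):** packaged version of `bsdp_of_oddStrictSelmerBound_of_unit` with the
certificate record and surjectivity for the twist named by the record. (Surjectivity of
`ρ_{V,p^∞}` is that of `ρ_{W,p^∞}` up to the quadratic twist; the record carries `V`, so it is
asked of `V`.) CONDITIONAL on the typed inputs; nothing booked.
[cite: Kobayashi2003, Thm. 4.1 (p. 8)] [cite: Miller2011LMS, Def. 1.1] -/
theorem bsdp_of_oddBranchUnitCertificate (hGZK : rank_eq_analyticRank_of_analyticRank_le_one)
    (h : QuadraticBranchOddStrictSelmerBoundAt W p) (hL6 : StrictSelmerDominatesShaAt W p)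
    (hp : p ≠ 2)
    (hcert : ∃ (V : WeierstrassCurve ℚ) (_ : V.IsElliptic) (_ : V.IsGloballyMinimal)
      (C : VariableChange ℚ) (N : ℕ) (_ : NeZero N) (f : CuspForm (Gamma0 N) 2) (ϖ : ℚ)
      (Lη : IwasawaAlgebra p),
      C • W.quadraticTwist ((-1) ^ (p / 2) * p) = V ∧
      V.HasGoodReductionAtPrime p ∧ V.frobeniusTrace p = 0 ∧
      (∀ m : ℕ, V.HasSurjectiveModNGaloisRep (p ^ m : ℕ)) ∧ IsNewformOf V f ∧
      (if Even (p / 2) then (ϖ : ℝ) * V.realPeriodRat = plusPeriod f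
          else (ϖ : ℝ) * V.imaginaryPeriodRat = minusPeriod f) ∧
      IsQuadraticBranchMinusLFunction f p ϖ Lη ∧ IsUnit (PowerSeries.coeff 1 Lη))
    (hsha : ∃ q : ℚ, shaAn W = (q : ℂ) ∧ padicValRat p q = 0) (hr : W.analyticRank = 1) :
    BSDp W p := by
  obtain ⟨V, _, _, C, N, _, f, ϖ, Lη, hC, hgood, hap, hsurj, hf, hϖ, hL, hunit⟩ := hcert
  exact bsdp_of_oddStrictSelmerBound_of_unit W p hGZK h hL6 hp hC hgood hap hsurj hf hϖ hL hunit
    hsha hr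

omit [W.IsElliptic] [W.IsGloballyMinimal] in
/-- The certificate record with surjectivity implies the bare sub-class predicate
`OddBranchUnitCertificateAt W p` (forgetting the image clause). Bookkeeping for the census key.
[cite: Kobayashi2003, (3.5) and (3.7) (p. 7)] -/
theorem oddBranchUnitCertificateAt_of_record
    (hcert : ∃ (V : WeierstrassCurve ℚ) (_ : V.IsElliptic) (_ : V.IsGloballyMinimal)
      (C : VariableChange ℚ) (N : ℕ) (_ : NeZero N) (f : CuspForm (Gamma0 N) 2) (ϖ : ℚ)
      (Lη : IwasawaAlgebra p),
      C • W.quadraticTwist ((-1) ^ (p / 2) * p) = V ∧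
      V.HasGoodReductionAtPrime p ∧ V.frobeniusTrace p = 0 ∧
      (∀ m : ℕ, V.HasSurjectiveModNGaloisRep (p ^ m : ℕ)) ∧ IsNewformOf V f ∧
      (if Even (p / 2) then (ϖ : ℝ) * V.realPeriodRat = plusPeriod f
          else (ϖ : ℝ) * V.imaginaryPeriodRat = minusPeriod f) ∧
      IsQuadraticBranchMinusLFunction f p ϖ Lη ∧ IsUnit (PowerSeries.coeff 1 Lη)) :
    OddBranchUnitCertificateAt W p := by
  obtain ⟨V, hVe, hVm, C, N, hN, f, ϖ, Lη, hC, hgood, hap, -, hf, hϖ, hL, hunit⟩ := hcert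
  exact ⟨V, hVe, hVm, C, N, hN, f, ϖ, Lη, hC, hgood, hap, hf, hϖ, hL, hunit⟩

end Consumers

end Summit.BirchSwinnertonDyer.Rank1Residual.Additive

end
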